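import Summits.Ventures.AbcSig.Rows.TemplateBC
import Summits.Ventures.AbcSig.Levels.N3872
import Summits.Ventures.AbcSig.Levels.N242

/-!
# Venture AbcSig — ROW `Xn8Yn11Z2`: `xⁿ + 8yⁿ = 11 z²` (FAMILY C1b, `α = 3`; GENERATED by p-lean gen3/leanrow_c1b.py)

HONEST FRAMING. A row of a COMPUTATION cell (`pub-abcsig`); a CONDITIONAL theorem, no claim on ABC or any summit.
Hypotheses: `BS04Package` (CITED: [BS04] Lemma 3.3 + (3.1) + Lemma 4.2), `DataComplete` at the levels 3872 (`y` odd,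
case (iv)₃) and 242 (`y` even, case (v₇)) (COMPUTED, certified level files), and the listed per-orbit exclusions `hX_…`
(CITED; the row of record's R5 names the printed argument / module for each: [BS04, Prop. 4.6] for the CM orbits,
module M6c CM-congruence certificates). Everything else is kernel-checked (`Rows/TemplateBC.lean`, `Levels/N….lean`).
Exponent range: prime `n ≥ 13`; `x·y ≠ ±1`.
Row of record: `census/rows/C1b/C1b-C11-a3.md` (sha256 `3be95bf210fe77d0…`; R8 SIGNED 2026-08-22T20:26:49Z by referee ref-g17; lead RULING RANK-C11a3): x^n + 8y^n = 11z^2 has no solution in nonzero pairwise coprime integers with |xy| > 1 for every prime n ≥ 13 — in particular at n = 13, the ONE explicit printed exception (C, α, n) = (11, 3, 13) of [BS04, Thm. 1.2] (lit/FRESHNESS.md §F-C11a3: not found in print after 2004). At n = 13 the CM(ℚ(i)) orbits 3872.6/7/8/24/25/26/27 are excluded by [BS04, Prop. 4.6] with the printed rank-0 fact for 26B/208D (CITED hypotheses here) and the pair 3872.36/.37 by module M6c (CM congruence certificates; CITED hypotheses here); every other orbit of 3872 and all of 242 are eliminated by kernel-checked sieve certificates. The row of record prints n ≥ 7, n ∉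 {7, 11}.
-/

namespace Summit.Ventures.AbcSig

/-- Row `Xn8Yn11Z2`: no primitive solution of `xⁿ + 8yⁿ = 11 z²` with `x·y ≠ ±1` for prime `n ≥ 13`,
conditional on the named hypotheses. -/
theorem row_Xn8Yn11Z2 (M : NewformModel) (hP : M.BS04Package)
    (hD3872 : M.DataComplete 3872 level3872Orbits) (hD242 : M.DataComplete 242 level242Orbits)
    (n : ℕ) (hn : n.Prime) (hmin : 13 ≤ n)
    (hX_orbit_3872_6 : M.Excludes 3872 orbit_3872_6 (famBC 3 11 n (fun _ b => ¬ 2 ∣ b)))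
    (hX_orbit_3872_7 : M.Excludes 3872 orbit_3872_7 (famBC 3 11 n (fun _ b => ¬ 2 ∣ b)))
    (hX_orbit_3872_8 : M.Excludes 3872 orbit_3872_8 (famBC 3 11 n (fun _ b => ¬ 2 ∣ b)))
    (hX_orbit_3872_24 : n ∈ ([11, 13] : List ℕ) → M.Excludes 3872 orbit_3872_24 (famBC 3 11 n (fun _ b => ¬ 2 ∣ b)))
    (hX_orbit_3872_25 : n ∈ ([11, 13] : List ℕ) → M.Excludes 3872 orbit_3872_25 (famBC 3 11 n (fun _ b => ¬ 2 ∣ b)))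
    (hX_orbit_3872_26 : n ∈ ([11, 13] : List ℕ) → M.Excludes 3872 orbit_3872_26 (famBC 3 11 n (fun _ b => ¬ 2 ∣ b)))
    (hX_orbit_3872_27 : n ∈ ([11, 13] : List ℕ) → M.Excludes 3872 orbit_3872_27 (famBC 3 11 n (fun _ b => ¬ 2 ∣ b)))
    (hX_orbit_3872_36 : n ∈ ([13] : List ℕ) → M.Excludes 3872 orbit_3872_36 (famBC 3 11 n (fun _ b => ¬ 2 ∣ b)))
    (hX_orbit_3872_37 : n ∈ ([13] : List ℕ) → M.Excludes 3872 orbit_3872_37 (famBC 3 11 n (fun _ b => ¬ 2 ∣ b)))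
    (x y z : ℤ) (hxy1 : x * y ≠ 1) (hxy2 : x * y ≠ -1) : ¬ IsPrimitiveSolution 1 (2 ^ 3) 11 n x y z := by
  have h7 : 7 ≤ n := by omega
  have hC : Nat.Prime 11 := by norm_num
  have hsq : Squarefree (11 : ℕ) := (Nat.prime_iff.mp hC).squarefree
  have hnC : ¬ n ∣ 11 := by
    intro h
    rcases (Nat.dvd_prime hC).mp h with h1 | h1 <;> omega
  by_cases hy : 2 ∣ y
  · exact branchBC_v7 3 11 hsq (by decide) M hP hD242 n hn h7 hnC (by omega)
      (level242_sieve n hn h7 (fun o => M.Excludes 242 o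
      (famBC 3 11 n (fun _ b => 2 ∣ b))) (fun h => absurd h (by simp only [List.mem_cons, List.not_mem_nil, or_false]; omega)) (fun h => absurd h (by simp only [List.mem_cons, List.not_mem_nil, or_false]; omega)) (fun h => absurd h (by simp only [List.mem_cons, List.not_mem_nil, or_false]; omega)) (fun h => absurd h (by simp only [List.mem_cons, List.not_mem_nil, or_false]; omega)))
      x y z hy hxy1 hxy2
  · exact branchBC_iv3 11 hsq (by decide) M hP hD3872 n hn h7 hnC
      (level3872_sieve n hn h7 (fun o => M.Excludes 3872 o
      (famBC 3 11 n (fun _ b => ¬ 2 ∣ b))) (fun h => absurd h (by simp only [List.mem_cons, List.not_mem_nil, or_false]; omega)) (fun h => absurd h (by simp only [List.mem_cons, List.not_mem_nil, or_false]; omega)) (fun h => absurd h (by simp only [List.mem_cons, List.not_mem_nil, or_false]; omega)) hX_orbit_3872_6 hX_orbit_3872_7 hX_orbit_3872_8 (fun h => absurd h (by simp only [List.mem_cons, List.not_mem_nil, or_false]; omega)) (fun h => absurd h (by simp only [List.mem_cons, List.not_mem_nil, or_false]; omega)) (fun h => absurd h (by simp only [List.mem_cons, List.not_mem_nil, or_false];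 omega)) hX_orbit_3872_24 hX_orbit_3872_25 hX_orbit_3872_26 hX_orbit_3872_27 (fun h => absurd h (by simp only [List.mem_cons, List.not_mem_nil, or_false]; omega)) (fun h => absurd h (by simp only [List.mem_cons, List.not_mem_nil, or_false]; omega)) (fun h => absurd h (by simp only [List.mem_cons, List.not_mem_nil, or_false]; omega)) (fun h => absurd h (by simp only [List.mem_cons, List.not_mem_nil, or_false]; omega)) (fun h => absurd h (by simp only [List.mem_cons, List.not_mem_nil, or_false]; omega)) (fun h => absurd h (by simp only [List.mem_cons, List.not_mem_nil, or_false]; omega)) hX_orbit_3872_36 hX_orbit_3872_37)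
      x y z hy hxy1 hxy2

end Summit.Ventures.AbcSig
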